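import Literature.NumberTheory.LFunctions.Zhang2022.KnifeEdgeEllVernier
import Literature.NumberTheory.LFunctions.Zhang2022.DetectorTemplate
import Literature.NumberTheory.LFunctions.Zhang2022.SkeletonAssembly
import Literature.NumberTheory.LFunctions.Zhang2022.Section4Prop22Eventually

/-!
# §D edge ell — card `ell-vernier-far-pair`: the design's OWN discrete mean and its positivity ENDGAME, proved
# with the zero-detector weight as a parameter (K4 in the Lemma 2.3 slot)

Y. Zhang, *Discrete mean estimates and the Landau–Siegel zero*, arXiv:2211.02515v1 [Zhang2022LandauSiegel] — an
unrefereed manuscript under adjudication. **WHAT THIS IS NOT: not a claim about Theorems 1–2 of arXiv:2211.02515,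
about Landau–Siegel zeros, about Parity, or about a repaired `Margin232`; every bare `Prop` below is a DEFINITION
asserted by no one (the card's cruxes, shapes ON a design), and every `theorem` is an implication between them and
named nodes of the typed skeleton.** «The programme SEARCHES and TYPES; no claim about Landau–Siegel zeros, Theorems
1–2 of arXiv:2211.02515 or a repaired Margin232 until a kernel theorem says so.» (LANDAU–SIEGEL programme F-S3, cell
`landau-siegel`, §D edge ell; typer ls-knife-typer-2 g3; card `knife/ell/idea-2/CARD-ell-vernier-far-pair.md`
sha16 42b2249874b87f56; companion of `KnifeEdgeEllVernier.lean` (FL0–FL4, K2, K4, Control, Booking, Pinned).)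

## Why this file (tribunal desk T1 pre-reading 2026-08-26T23:58:04Z, point (4); director-frontier 00:11:06Z (3):
«own discrete mean + endgame in glue» is a BINDING birth condition)
The cell's positivity endgame of record, `KnifeEdge.eventually_not_assumptionA_of_negative_mainTerm` (p456081), is
weighted by the PRINTED `𝔠*(ρ,ψ)` (`KnifeEdge.discMean c'`, `Skeleton.cstar` by `rfl`) and consumes `Skeleton.Lemma23`;
a vernier `closes` routed through it would leave K4 (`VernierPositivity`) as decoration and state K3 for the wrong
weight. The far-pair design therefore needs ITS OWN discrete mean — Zhang's double sum with the vernier weight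
`𝔠*_J(ρ,ψ) = cstarVernier θ c'` — and ITS OWN endgame, the len proof with the weight as a parameter and K4 in the
Lemma 2.3 slot. This file supplies exactly that and nothing about the value of the main term (`𝔅^V_θ`, the card's D1 /
K1 / K3 proper, is NOT guessed here: the main-term constant enters as the slot `m : ℝ` of `VernierDict`).

## Contents
* Part 1 — the VERNIER DETECTOR `vernierDetector θ c' Fam : DetTemplate.Detector` (the B-det template's datum:
  sub-family `Fam`, sampled points `𝔷(ψ)`, weight `𝔠*_J(ρ,ψ)·ω(ρ)`), the two sub-family selectors `psiOneFam`
  (Zhang's `Ψ₁`) and `coherentFam` (the card's coherent sub-family `CoherentMember`), and the card's discrete mean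
  `Ξ_J(F) = vernierMean θ c' Fam χ F = Σ_{ψ ∈ Fam} Σ_{ρ ∈ 𝔷(ψ)} Re 𝔠*_J(ρ,ψ)·‖F(ψ,ρ)‖²·Re ω(ρ)` (the shape of
  `KnifeEdge.discMean`, weight swapped); bridge `vernierMean_eq_re_mean` to the template's complex mean on real weights.
* Part 2 — the card's Assembly items as SHAPES (bare `Prop`s ON the design, main-term value a slot):
  (i) `VernierLower θ c' Fam F` («`Ξ_J(u,u) ≥ −o(𝔞𝔓)`», what K2 ∧ K4 ∧ P1 are to deliver on the admissible class),
  (ii) `VernierDict θ c' Fam F m` («`Ξ_J(𝔥,𝔥) = 𝔞𝔓(m + o(1))`», K3's shape with `m` the slot for `𝔅^V_θ(G,G)`);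
  (iii) is `m < 0` (K1's shape).
* Part 3 — PROVED: `eventually_not_assumptionA_of_vernier` ((i) ∧ (ii) ∧ `m < 0` ⇒ (A) fails for all large `D`),
  `theorem1_of_vernier` / `theorem2_of_vernier` (⇒ the manuscript's Theorem 1 / 2 shapes, via
  `Skeleton.theorem1_of_eventually_not_assumptionA`); and K4 IN THE LEMMA 2.3 SLOT: `vernierWeights_nonneg`
  (K4 ∧ Prop. 2.2 (i) ⇒ under (A), eventually, every weight `Re 𝔠*_J·Re ω ≥ 0` on the coherent sub-family),
  `vernierLower_coherent` (⇒ (i) holds EXACTLY on `coherentFam`, every `F`), whence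
  `theorem1_of_vernier_coherent : VernierDict θ c' coherentFam F m → m < 0 → VernierPositivity θ c' → Prop22i → Theorem1`
  and its CLOSED twin `theorem1_of_vernier_coherent_closed` with `Prop22i` discharged by the tree theorem
  `Skeleton.prop22i_holds` — the glue a route's `closes` can cite with only the card's cruxes displayed.
References: Zhang, arXiv:2211.02515v1, §2 (2.13)–(2.17), Lemma 2.3, Prop. 2.2 (i), p. 6 [cite: Zhang2022LandauSiegel,
§2 (2.14)–(2.17), Lemma 2.3, Prop. 2.2]. In-tree: `KnifeEdge.discMean`/`eventually_not_assumptionA_of_negative_mainTerm`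
(p456081), `DetTemplate.Detector`/`positive_zhang`/`re_mean_normSq_nonneg`, `Skeleton.prop22i_holds`.
-/

noncomputable section

open scoped Real ComplexConjugate

namespace Literature.NumberTheory.LFunctions.Zhang2022.KnifeEdgeEll.Vernier

open Literature.NumberTheory.LFunctions.Zhang2022 Skeleton DetTemplate

/-! ## Part 1 — the vernier detector and the card's discrete mean `Ξ_J` -/

/-- A sub-family selector: for each modulus `D` and real primitive `χ (mod D)` a set of members `ψ (mod p)` of Zhang's
family (the `fam` field of `DetTemplate.Detector`). [cite: Zhang2022LandauSiegel, §2 (2.16); §3 p. 7] -/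
abbrev FamSel := (D : ℕ) → [NeZero D] → DirichletCharacter ℂ D → Set (Chr D)

/-- Zhang's sub-family `Ψ₁` as a selector (the printed detector's family, `DetTemplate.zhang`).
[cite: Zhang2022LandauSiegel, §3 p. 7] -/
def psiOneFam : FamSel := fun _ _ χ => PsiOne χ

/-- The card's COHERENT sub-family as a selector: `{ψ ∈ Ψ₁ : sup_window |(L′/L)(1+2it,ψ²)| ≤ 𝓛^{1/2}}`
(`CoherentMember`, the family K2/K4/P1 speak about). [cite: Zhang2022LandauSiegel, §3 p. 7; §4 (4.11)] -/
def coherentFam : FamSel := fun _ _ χ => {x | CoherentMember χ x}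

/-- A coherent member is a member of `Ψ₁`. [cite: Zhang2022LandauSiegel, §3 p. 7] -/
theorem coherentFam_subset_psiOne {D : ℕ} [NeZero D] (χ : DirichletCharacter ℂ D) :
    coherentFam D χ ⊆ PsiOne χ := fun _ hx => hx.1

/-- **The VERNIER DETECTOR** (B-det template datum): sub-family `Fam`, sampled points `𝔷(ψ)` (2.14), weight
`𝔠*_J(ρ,ψ)·ω(ρ)` with the far-pair zero weight `cstarVernier θ c'` (`−i·M(ρ+β₁)M(ρ+β_J)M(ρ+β_J′)/M′(ρ)`, far pair on
the true fence) in place of the printed `𝔠*`. [cite: Zhang2022LandauSiegel, §2 p. 5, (2.13)–(2.16)] -/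
def vernierDetector (θ c' : ℝ) (Fam : FamSel) : Detector where
  fam := Fam
  pts := fun D _ _ x => zeroSet D x
  wt := fun D _ _ x ρ => cstarVernier θ c' D x ρ * omegaW D ρ

variable (θ c' : ℝ) (Fam : FamSel) {D : ℕ} [NeZero D] (χ : DirichletCharacter ℂ D)

/-- The index set of the vernier double sum: pairs `(ψ, ρ)`, `ψ ∈ Fam`, `ρ ∈ 𝔷(ψ)` (for `Fam = psiOneFam` it is
`Skeleton.idx χ`, `vernierIdx_psiOne`). [cite: Zhang2022LandauSiegel, §2 (2.16)] -/
def vernierIdx : Finset ((_ : Chr D) × ℂ) := (vernierDetector θ c' Fam).idx χ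

/-- On `Ψ₁` the vernier index set is the printed one. [cite: Zhang2022LandauSiegel, §2 (2.16)] -/
theorem vernierIdx_psiOne : vernierIdx θ c' psiOneFam χ = Skeleton.idx χ := rfl

/-- **The card's discrete mean `Ξ_J(F) = Σ_{ψ ∈ Fam} Σ_{ρ ∈ 𝔷(ψ)} Re 𝔠*_J(ρ,ψ)·‖F(ψ,ρ)‖²·Re ω(ρ)`** of a table of
values `F(ψ,ρ)` — `KnifeEdge.discMean` with the weight `𝔠* ↦ 𝔠*_J` (and the family a parameter).
[cite: Zhang2022LandauSiegel, §2 (2.16)–(2.17), (2.33)] -/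
def vernierMean (F : Chr D → ℂ → ℂ) : ℝ :=
  ∑ i ∈ vernierIdx θ c' Fam χ, (cstarVernier θ c' D i.1 i.2).re * ‖F i.1 i.2‖ ^ 2 * (omegaW D i.2).re

variable {θ c' Fam χ}

/-- Membership in the index set is membership in the family and in `𝔷(ψ)` (finite components; on an infinite
component the index set is `∅`). [cite: Zhang2022LandauSiegel, §2 (2.16)] -/
theorem mem_fam_of_mem_vernierIdx {i : (_ : Chr D) × ℂ} (hi : i ∈ vernierIdx θ c' Fam χ) :
    i.1 ∈ Fam D χ ∧ i.2 ∈ zeroSet D i.1 := by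
  obtain ⟨hx, hρ⟩ := Finset.mem_sigma.mp hi
  exact ⟨mem_of_mem_finsetOf hx, mem_of_mem_finsetOf hρ⟩

/-- **(2.16) for the vernier weight at a fixed modulus:** non-negative weights `Re 𝔠*_J·Re ω ≥ 0` at every index give
`Ξ_J(F) ≥ 0` for every `F`. [cite: Zhang2022LandauSiegel, §2 (2.16), Lemma 2.3] -/
theorem vernierMean_nonneg
    (hw : ∀ i ∈ vernierIdx θ c' Fam χ, 0 ≤ (cstarVernier θ c' D i.1 i.2).re * (omegaW D i.2).re)
    (F : Chr D → ℂ → ℂ) : 0 ≤ vernierMean θ c' Fam χ F := by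
  unfold vernierMean
  refine Finset.sum_nonneg fun i hi => ?_
  have := mul_nonneg (hw i hi) (sq_nonneg ‖F i.1 i.2‖)
  nlinarith

/-- Bridge to the template: on REAL weights (`Im 𝔠*_J = 0`, `Im ω = 0` at every index) the card's `Ξ_J(F)` is the real
part of the `vernierDetector`-weighted mean of `F·F̄` (`DetTemplate.Detector.mean`), so the template's nodes
(`MeanEval`, `Lemma81`, `Prop71`) speak about the same number. [cite: Zhang2022LandauSiegel, §2 (2.16)] -/
theorem vernierMean_eq_re_mean (hc : ∀ i ∈ vernierIdx θ c' Fam χ, (cstarVernier θ c' D i.1 i.2).im = 0)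
    (hω : ∀ i ∈ vernierIdx θ c' Fam χ, (omegaW D i.2).im = 0) (F : Chr D → ℂ → ℂ) :
    vernierMean θ c' Fam χ F = ((vernierDetector θ c' Fam).mean χ fun x ρ => F x ρ * conj (F x ρ)).re := by
  unfold vernierMean Detector.mean vernierIdx
  rw [Complex.re_sum]
  refine Finset.sum_congr rfl fun i hi => ?_
  have h1 := hc i hi
  have h2 := hω i hi
  simp only [vernierDetector] at h1 h2 ⊢
  rw [Complex.mul_conj, Complex.mul_re, Complex.ofReal_re, Complex.ofReal_im, mul_zero, sub_zero,
    Complex.mul_re, h1, h2, mul_zero, sub_zero, Complex.normSq_eq_norm_sq]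
  ring

/-! ## Part 2 — the card's Assembly items (i), (ii) as shapes ON the design (bare `Prop`s, asserted by no one) -/

/-- A family of value tables `F_D,χ(ψ,ρ)` (the card's test vectors `u`, `𝔥_G` evaluated at the sampled pairs).
[cite: Zhang2022LandauSiegel, §2 (2.16)–(2.17)] -/
abbrev ValueTable := (D : ℕ) → DirichletCharacter ℂ D → Chr D → ℂ → ℂ

/-- **Assembly item (i) — `Ξ_J(u,u) ≥ −o(𝔞𝔓)`** (shape; what the card's K2 ∧ K4 ∧ P1 are to deliver for the
admissible class): for every `ε > 0`, eventually in `D`, under (A), `−ε·𝔞·𝔓 ≤ Ξ_J(F_D,χ)`. On the coherent sub-family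
it holds exactly (`vernierLower_coherent`, from K4 and Prop. 2.2 (i)). OPEN shape, asserted by no one.
[cite: Zhang2022LandauSiegel, §2 (2.16), Lemma 2.3, Prop. 2.2] -/
def VernierLower (θ c' : ℝ) (Fam : FamSel) (F : ValueTable) : Prop :=
  ∀ ε : ℝ, 0 < ε → ForAllLarge fun D _ χ => AssumptionA D χ →
    -(ε * frakA χ * frakP D) ≤ vernierMean θ c' Fam χ (F D χ)

/-- **Assembly item (ii) — the vernier DICTIONARY `Ξ_J(𝔥,𝔥) = 𝔞𝔓·(m + o(1))`** (K3's shape; the constant `m` is the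
SLOT the card's main-term form `𝔅^V_θ(G,G)` fills once D1 fixes it — not guessed here): for every `ε > 0`, eventually
in `D`, under (A), `|Ξ_J(F_D,χ) − m·𝔞·𝔓| ≤ ε·𝔞·𝔓` (`𝔞 = Skeleton.frakA χ` (2.31), `𝔓 = Skeleton.frakP D` (2.9); the
shape of `KnifeEdge.EStarLen`'s conclusion / `Skeleton.Eval823`). OPEN shape, asserted by no one.
[cite: Zhang2022LandauSiegel, §2 (2.31)–(2.33); §8 (8.23)] -/
def VernierDict (θ c' : ℝ) (Fam : FamSel) (F : ValueTable) (m : ℝ) : Prop :=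
  ∀ ε : ℝ, 0 < ε → ForAllLarge fun D _ χ => AssumptionA D χ →
    |vernierMean θ c' Fam χ (F D χ) - m * frakA χ * frakP D| ≤ ε * frakA χ * frakP D

/-! ## Part 3 — PROVED: the endgame (card Assembly «(A) ⇒ 0 ≤ 𝔞𝔓(−v + o(1)) < 0»), and K4 in the Lemma 2.3 slot -/

section Endgame

variable {θ c' m : ℝ} {Fam : FamSel} {F : ValueTable}

/-- **THE VERNIER ENDGAME.** (i) `Ξ_J ≥ −o(𝔞𝔓)` and (ii) `Ξ_J = 𝔞𝔓(m + o(1))` with (iii) `m < 0` are incompatible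
with (A) for every large modulus: `𝔞 ≥ a₀ > 0` under (A) (`Skeleton.frakALowerBound_holds`) and `𝔓 > 0`
(`Skeleton.frakP_eventually_pos`) give `−(|m|/3)𝔞𝔓 ≤ Ξ_J ≤ (m + |m|/3)𝔞𝔓 < −(|m|/3)𝔞𝔓`. No Cauchy–Schwarz, no §18
margin. [cite: Zhang2022LandauSiegel, §2 p. 6, (2.16)] -/
theorem eventually_not_assumptionA_of_vernier (hlow : VernierLower θ c' Fam F) (hdict : VernierDict θ c' Fam F m)
    (hm : m < 0) :
    ∃ D₀ : ℕ, ∀ (D : ℕ) [NeZero D] (χ : DirichletCharacter ℂ D),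
      D₀ ≤ D → χ.IsQuadratic → χ.IsPrimitive → ¬ AssumptionA D χ := by
  have hε : 0 < -m / 3 := by linarith
  obtain ⟨D₁, h₁⟩ := (hlow (-m / 3) hε).and (hdict (-m / 3) hε)
  obtain ⟨a₀, ha₀, D₂, h₂⟩ := frakALowerBound_holds
  obtain ⟨D₃, h₃⟩ := frakP_eventually_pos
  refine ⟨max D₁ (max D₂ D₃), fun D _ χ hD hq hp hA => ?_⟩
  have hD₁ : D₁ ≤ D := le_trans (le_max_left _ _) hD
  have hD₂ : D₂ ≤ D := le_trans (le_trans (le_max_left _ _) (le_max_right _ _)) hD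
  have hD₃ : D₃ ≤ D := le_trans (le_trans (le_max_right _ _) (le_max_right _ _)) hD
  obtain ⟨hl, hd⟩ := h₁ D χ hD₁ hq hp
  have hl' := hl hA
  have hd' := (abs_le.mp (hd hA)).2
  have hA0 : 0 < frakA χ := lt_of_lt_of_le ha₀ (h₂ D χ hD₂ hq hp hA)
  have hP0 : 0 < frakP D := h₃ D hD₃
  have hX : 0 < frakA χ * frakP D := mul_pos hA0 hP0
  nlinarith

/-- **⇒ Theorem 1 of the manuscript** (`L(1,χ) > c₁(log D)⁻²⁰²²`, `Skeleton.Theorem1`), via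
`Skeleton.theorem1_of_eventually_not_assumptionA`. The three hypotheses are the card's Assembly items — shapes, OPEN.
[cite: Zhang2022LandauSiegel, §1 Theorem 1; §2 p. 6] -/
theorem theorem1_of_vernier (hlow : VernierLower θ c' Fam F) (hdict : VernierDict θ c' Fam F m) (hm : m < 0) :
    Theorem1 :=
  Skeleton.theorem1_of_eventually_not_assumptionA (eventually_not_assumptionA_of_vernier hlow hdict hm)

/-- … and Theorem 2 (`Skeleton.Theorem2`, from Theorem 1 by `Skeleton.theorem2_of_theorem1`).
[cite: Zhang2022LandauSiegel, §1 Theorem 2] -/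
theorem theorem2_of_vernier (hlow : VernierLower θ c' Fam F) (hdict : VernierDict θ c' Fam F m) (hm : m < 0) :
    Theorem2 :=
  Skeleton.theorem2_of_theorem1 (theorem1_of_vernier hlow hdict hm)

/-- **K4 IN THE LEMMA 2.3 SLOT:** `VernierPositivity θ c'` (K4: `𝔠*_J` real and `≥ 0` on the coherent sub-family,
under (A)) and Prop. 2.2 (i) (sampled zeros on the critical line ⇒ `ω(ρ)` real and `> 0`, `Skeleton.omegaW_re_pos`)
give, eventually in `D` and under (A), non-negative REAL weights at every index of the coherent double sum — the
analogue of `KnifeEdge.weights_nonneg_of` / `DetTemplate.positive_zhang` for the vernier detector.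
[cite: Zhang2022LandauSiegel, §2 Lemma 2.3, Prop. 2.2 (i), (2.15)] -/
theorem vernierWeights_nonneg (hK4 : VernierPositivity θ c') (h22 : Prop22i) :
    ForAllLarge fun D _ χ => AssumptionA D χ → ∀ i ∈ vernierIdx θ c' coherentFam χ,
      ((cstarVernier θ c' D i.1 i.2).im = 0 ∧ (omegaW D i.2).im = 0) ∧
        0 ≤ (cstarVernier θ c' D i.1 i.2).re * (omegaW D i.2).re := by
  have h3 : ForAllLarge fun D _ _ => 3 ≤ D := ForAllLarge.of_le 3 fun D _ _ hD _ _ => hD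
  refine ((hK4.and h22).and h3).mono ?_
  intro D _ χ _ _ h hA i hi
  obtain ⟨⟨h4, hP22⟩, hD3⟩ := h
  obtain ⟨hx, hρ⟩ := mem_fam_of_mem_vernierIdx hi
  obtain ⟨him, hre⟩ := h4 hA i.1 hx i.2 hρ
  have hline : i.2.re = 1 / 2 := hP22 i.1 hx.1 i.2 (mem_prodZeroSetOmega_of_mem_zeroSet χ hρ)
  obtain ⟨hωre, hωim⟩ := omegaW_re_pos hD3 hline
  exact ⟨⟨him, hωim⟩, mul_nonneg hre hωre.le⟩

/-- **Assembly item (i) on the coherent sub-family is a CONSEQUENCE of K4 and Prop. 2.2 (i)** — exactly, for every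
table of values: `Ξ_J(F) ≥ 0 ≥ −ε𝔞𝔓` (`𝔞 ≥ 0`, `𝔓 ≥ 0`: `Skeleton.frakA_nonneg`, `Skeleton.frakP_nonneg`).
[cite: Zhang2022LandauSiegel, §2 (2.16), Lemma 2.3, Prop. 2.2 (i)] -/
theorem vernierLower_coherent (hK4 : VernierPositivity θ c') (h22 : Prop22i) (F : ValueTable) :
    VernierLower θ c' coherentFam F := by
  intro ε hε
  refine (vernierWeights_nonneg hK4 h22).mono ?_
  intro D _ χ _ _ h hA
  have hpos := vernierMean_nonneg (fun i hi => (h hA i hi).2) (F D χ)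
  have : 0 ≤ ε * frakA χ * frakP D := by
    have := frakA_nonneg χ
    have := frakP_nonneg D
    positivity
  linarith

/-- On the coherent sub-family, under K4 and Prop. 2.2 (i), the card's `Ξ_J` IS the template's mean (real weights).
[cite: Zhang2022LandauSiegel, §2 (2.16)] -/
theorem vernierMean_coherent_eq_re_mean (hK4 : VernierPositivity θ c') (h22 : Prop22i) :
    ForAllLarge fun D _ χ => AssumptionA D χ → ∀ F : Chr D → ℂ → ℂ,
      vernierMean θ c' coherentFam χ F =
        ((vernierDetector θ c' coherentFam).mean χ fun x ρ => F x ρ * conj (F x ρ)).re :=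
  (vernierWeights_nonneg hK4 h22).mono fun _ _ _ _ _ h hA F =>
    vernierMean_eq_re_mean (fun i hi => (h hA i hi).1.1) (fun i hi => (h hA i hi).1.2) F

/-- **The coherent-family endgame with K4 in the Lemma 2.3 slot:** a vernier dictionary with NEGATIVE main-term
constant on the coherent sub-family, K4, and Prop. 2.2 (i) give Theorem 1. Displayed: K3's shape (`VernierDict`, the
slot `m` to be filled by `𝔅^V_θ(G,G)` of the card's D1), K1's shape (`m < 0`), K4 (`VernierPositivity`), and the
manuscript's Prop. 2.2 (i). [cite: Zhang2022LandauSiegel, §1 Theorem 1; §2 p. 6, Lemma 2.3, Prop. 2.2] -/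
theorem theorem1_of_vernier_coherent (hdict : VernierDict θ c' coherentFam F m) (hm : m < 0)
    (hK4 : VernierPositivity θ c') (h22 : Prop22i) : Theorem1 :=
  theorem1_of_vernier (vernierLower_coherent hK4 h22 F) hdict hm

/-- **CLOSED twin** — Prop. 2.2 (i) is a tree theorem (`Skeleton.prop22i_holds`, composed from the landed §4 chain),
so only the card's own cruxes are displayed: `VernierDict θ c' coherentFam F m → m < 0 → VernierPositivity θ c' →
Theorem1`. (K2 `VernierCoherence…` enters only through a future proof of K4; P1 through the choice of `F`/K3.)
[cite: Zhang2022LandauSiegel, §1 Theorem 1; §2 p. 6, Lemma 2.3] -/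
theorem theorem1_of_vernier_coherent_closed (hdict : VernierDict θ c' coherentFam F m) (hm : m < 0)
    (hK4 : VernierPositivity θ c') : Theorem1 :=
  theorem1_of_vernier_coherent hdict hm hK4 prop22i_holds

/-- … and Theorem 2, closed form. [cite: Zhang2022LandauSiegel, §1 Theorem 2] -/
theorem theorem2_of_vernier_coherent_closed (hdict : VernierDict θ c' coherentFam F m) (hm : m < 0)
    (hK4 : VernierPositivity θ c') : Theorem2 :=
  Skeleton.theorem2_of_theorem1 (theorem1_of_vernier_coherent_closed hdict hm hK4)

/-- **Obstruction bookkeeping (the B-AH side, cf. `KnifeEdge.not_eStarLenCloses_of_nonneg`):** if (i) holds for `F`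
then NO dictionary with a negative constant can hold for the same `F` while (A) holds for infinitely many moduli —
formally: (i) ∧ (ii) at `m < 0` force `¬(A)` eventually, so an (A)-consistent world prices every admissible vernier
dictionary at `m ≥ 0`. Recorded as the contrapositive shape the critic's K18/E-014 dichotomy uses.
[cite: Zhang2022LandauSiegel, §2 p. 6, (2.16)] -/
theorem vernierDict_nonneg_of_frequently_A (hlow : VernierLower θ c' Fam F) (hdict : VernierDict θ c' Fam F m)
    (hA : ∀ D₀ : ℕ, ∃ (D : ℕ) (_ : NeZero D) (χ : DirichletCharacter ℂ D),
      D₀ ≤ D ∧ χ.IsQuadratic ∧ χ.IsPrimitive ∧ AssumptionA D χ) : 0 ≤ m := by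
  refine le_of_not_gt fun hm => ?_
  obtain ⟨D₀, h⟩ := eventually_not_assumptionA_of_vernier hlow hdict hm
  obtain ⟨D, _, χ, hD, hq, hp, hAD⟩ := hA D₀
  exact h D χ hD hq hp hAD

end Endgame

end Literature.NumberTheory.LFunctions.Zhang2022.KnifeEdgeEll.Vernier

end
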